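import Mathlib
import HarnessLib

/-!
# One-dimensional viscosity rigidity, first order: one-sided slope conditions force monotonicity

Topic `Literature/Analysis/ODE`; theorems only (pure real analysis).  A continuous function `f`
on an open interval is a *viscosity supersolution of `u' = 0`* when every smooth test function
`φ` touching `f` from below at a point has `φ' ≥ 0` there (Crandall–Ishii–Lions 1992, §2); in one
dimension this forces `f` to be monotone, and the two-sided condition forces `f` to be constant.
These lemmas are the first-order half of the regularity bootstrap used by the crux line
`crossing-martingale` of `CardyRigidity` (stmt-CriticalPhenomena-0746, sub-problem
`CriticalPhenomena/CardyFormulaZ2`): there the far-field expansion of level-stopped crossing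
observables, applied to smooth test functions touching an unknown continuous kernel `f`, produces
exactly such one-sided conditions.  The second-order half (comparison with classical solutions of
`A u'' + B u' = 0`, `A > 0`) is the sibling file `ViscosityLinearSecondOrder.lean`.

* `exists_contDiff_eventuallyEq` — a function smooth near a point agrees near that point with a
  globally smooth function (bump-function cut-off); used to feed local test functions into
  hypotheses quantified over globally smooth ones.
* `monotoneOn_of_touchingBelow` — if every smooth `φ` touching `f` from below at a point of
  `(a,b)` has `φ' ≥ 0` there, then `f` is monotone on `(a,b)` (and the three sign/side variants,
  `antitoneOn_of_touchingAbove`, `antitoneOn_of_touchingBelow`, `monotoneOn_of_touchingAbove`);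
  `eq_of_touching` — both one-sided conditions with a common nonzero factor force `f` constant.

Mathlib has no viscosity solutions (searched `viscosity`, `touching`, `IsLocalMax.*deriv`); the
nearest tool is Fermat's `IsLocalMin.deriv_eq_zero`, which needs differentiability of `f`.

References: M. G. Crandall, H. Ishii, P.-L. Lions, *User's guide to viscosity solutions*, Bull.
AMS 27 (1992), §2 (definitions), §3 (comparison); the one-dimensional linear case treated here is
elementary and self-contained.
-/

noncomputable section

open Set Filter Topology Metric
open scoped ContDiff

namespace Literature.Analysis.ODE

/-! ### Smooth cut-off: local test functions are restrictions of global ones -/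

/-- A function that is smooth on a neighbourhood of `η₀` coincides near `η₀` with a globally
smooth function (multiply by a smooth bump supported inside the neighbourhood). [folklore] -/
theorem exists_contDiff_eventuallyEq {g : ℝ → ℝ} {η₀ : ℝ} {U : Set ℝ} (hU : U ∈ 𝓝 η₀)
    (hg : ContDiffOn ℝ ∞ g U) : ∃ φ : ℝ → ℝ, ContDiff ℝ ∞ φ ∧ φ =ᶠ[𝓝 η₀] g := by
  obtain ⟨ε, hε, hball⟩ := Metric.mem_nhds_iff.1 hU
  let χ : ContDiffBump η₀ := ⟨ε / 4, ε / 2, by positivity, by linarith⟩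
  refine ⟨fun η ↦ χ η * g η, ?_, ?_⟩
  · rw [contDiff_iff_contDiffAt]
    intro x
    by_cases hx : dist x η₀ < ε
    · have hmem : ball η₀ ε ∈ 𝓝 x := isOpen_ball.mem_nhds hx
      have hon : ContDiffOn ℝ ∞ (fun η ↦ χ η * g η) (ball η₀ ε) :=
        (χ.contDiff.contDiffOn).mul (hg.mono hball)
      exact hon.contDiffAt hmem
    · push Not at hx
      have hzero : (fun η ↦ χ η * g η) =ᶠ[𝓝 x] fun _ ↦ 0 := by
        have hmem : ball x (ε / 2) ∈ 𝓝 x := ball_mem_nhds x (by positivity)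
        filter_upwards [hmem] with y hy
        have hy' : dist y x < ε / 2 := hy
        have hdist : χ.rOut ≤ dist y η₀ := by
          show ε / 2 ≤ dist y η₀
          have := dist_triangle x y η₀
          rw [dist_comm x y] at this
          linarith
        simp [χ.zero_of_le_dist hdist]
      exact (contDiffAt_const (c := (0 : ℝ))).congr_of_eventuallyEq hzero
  · filter_upwards [χ.eventuallyEq_one] with η hη
    simp [hη]

/-! ### First order: one-sided derivative conditions force monotonicity -/

/-- **Touching from below with nonnegative slopes forces monotonicity.**  If `f` is continuous on
`(a,b)` and every globally smooth `φ` touching `f` from below at a point `η₀ ∈ (a,b)`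
(`φ η₀ = f η₀`, `φ ≤ f` near `η₀`) satisfies `0 ≤ φ'(η₀)`, then `f` is monotone on `(a,b)`
(`f` is a viscosity supersolution of `u' = 0`).  Proof: along a descent `f α > f β` the test
function `ℓ + θ - ε/(β - η)` (`ℓ` affine of negative slope, a pole pushing it below `f` at `β`)
touches `f` from below at an interior point with negative slope.
[cite: CrandallIshiiLions1992, §2] -/
theorem monotoneOn_of_touchingBelow {f : ℝ → ℝ} {a b : ℝ} (hf : ContinuousOn f (Ioo a b))
    (h : ∀ η₀ ∈ Ioo a b, ∀ φ : ℝ → ℝ, ContDiff ℝ ∞ φ → φ η₀ = f η₀ →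
      (∀ᶠ η in 𝓝 η₀, φ η ≤ f η) → 0 ≤ deriv φ η₀) :
    MonotoneOn f (Ioo a b) := by
  intro α hα β hβ hαβ
  rcases hαβ.eq_or_lt with rfl | hlt
  · exact le_rfl
  by_contra hcon
  push Not at hcon
  -- the descent and the affine minorant through `(β, f β)`
  set Δ := f α - f β with hΔ
  have hΔpos : 0 < Δ := by linarith
  have hβα : 0 < β - α := by linarith
  set k := -Δ / (2 * (β - α)) with hk
  have hkneg : k < 0 := by rw [hk]; exact div_neg_of_neg_of_pos (by linarith) (by positivity)
  set ℓ : ℝ → ℝ := fun η ↦ f β + k * (η - β) with hℓ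
  set m₀ := Δ / 2 with hm₀
  have hm₀pos : 0 < m₀ := by positivity
  have hℓα : ℓ α = f α - m₀ := by
    simp only [hℓ, hk, hm₀, hΔ]; field_simp; ring
  -- continuity of `f - ℓ` at `β`: it is `≤ m₀/2` on `[β - τ₀, β]`
  have hIcc : Icc α β ⊆ Ioo a b := fun η hη ↦ ⟨hα.1.trans_le hη.1, hη.2.trans_lt hβ.2⟩
  have hfc : ContinuousOn f (Icc α β) := hf.mono hIcc
  have hcontβ : ContinuousAt f β := hf.continuousAt (Ioo_mem_nhds hβ.1 hβ.2)
  have hev : ∀ᶠ η in 𝓝 β, f η - ℓ η < m₀ / 2 := by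
    have h1 : Tendsto (fun η ↦ f η - ℓ η) (𝓝 β) (𝓝 (f β - ℓ β)) :=
      hcontβ.tendsto.sub ((continuous_const.add (continuous_const.mul
        (continuous_id.sub continuous_const))).tendsto β)
    have h0 : f β - ℓ β = 0 := by simp [hℓ]
    rw [h0] at h1
    exact h1.eventually (gt_mem_nhds (by positivity))
  obtain ⟨τ₀, hτ₀pos, hτ₀⟩ : ∃ τ₀ > 0, τ₀ < β - α ∧ ∀ η, β - τ₀ ≤ η → η ≤ β → f η - ℓ η < m₀ / 2 := by
    obtain ⟨r, hrpos, hr⟩ := Metric.eventually_nhds_iff.1 hev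
    refine ⟨min (r / 2) ((β - α) / 2), by positivity, ?_, fun η h1 h2 ↦ hr ?_⟩
    · exact (min_le_right _ _).trans_lt (by linarith)
    · rw [Real.dist_eq, abs_sub_comm, abs_of_nonneg (by linarith)]
      have := min_le_left (r / 2) ((β - α) / 2)
      linarith
  obtain ⟨hτ₀lt, hτ₀f⟩ := hτ₀
  set η₁ := β - τ₀ with hη₁
  set ε := m₀ * τ₀ / 4 with hε
  have hεpos : 0 < ε := by positivity
  -- a lower bound for `f` on `[α, β]`
  obtain ⟨ηm, hηm, hmin⟩ := (isCompact_Icc (a := α) (b := β)).exists_isMinOn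
    (nonempty_Icc.2 hlt.le) hfc
  set mf := f ηm with hmf
  have hmf_le : ∀ η ∈ Icc α β, mf ≤ f η := fun η hη ↦ hmin hη
  have hmfα : mf ≤ f α := hmf_le α (left_mem_Icc.2 hlt.le)
  -- the right end `β'` of the compact interval on which we minimise `f - ψ`
  set τ₁ := min (τ₀ / 2) (ε / (f α - mf + 1)) with hτ₁
  have hden : 0 < f α - mf + 1 := by linarith
  have hτ₁pos : 0 < τ₁ := lt_min (by positivity) (div_pos hεpos hden)
  have hτ₁le : τ₁ ≤ τ₀ / 2 := min_le_left _ _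
  have hτ₁le' : τ₁ ≤ ε / (f α - mf + 1) := min_le_right _ _
  set β' := β - τ₁ with hβ'
  have hη₁β' : η₁ ≤ β' := by rw [hη₁, hβ']; linarith
  have hαη₁ : α < η₁ := by rw [hη₁]; linarith
  have hαβ' : α < β' := hαη₁.trans_le hη₁β'
  have hβ'β : β' < β := by rw [hβ']; linarith
  -- the test function with a pole at `β`
  set ψ : ℝ → ℝ := fun η ↦ ℓ η + m₀ - ε / (β - η) with hψ
  have hψα : f α - ψ α > 0 := by
    have : ψ α = f α - ε / (β - α) := by simp only [hψ, hℓα]; ring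
    rw [this]
    have : 0 < ε / (β - α) := div_pos hεpos hβα
    linarith
  have hψη₁ : f η₁ - ψ η₁ < 0 := by
    have h1 : f η₁ - ℓ η₁ < m₀ / 2 := hτ₀f η₁ le_rfl (by rw [hη₁]; linarith)
    have h2 : ψ η₁ = ℓ η₁ + m₀ - m₀ / 4 := by
      simp only [hψ, hη₁, hε]
      have : β - (β - τ₀) = τ₀ := by ring
      rw [this]
      field_simp
    rw [h2]; linarith
  have hψβ' : 0 ≤ f β' - ψ β' := by
    -- `ψ β' ≤ ℓ α + m₀ - ε/τ₁ ≤ f α - ε/τ₁ ≤ mf ≤ f β'`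
    have hℓmono : ℓ β' ≤ ℓ α := by
      simp only [hℓ]
      have : k * (β' - β) ≤ k * (α - β) := mul_le_mul_of_nonpos_left (by linarith) hkneg.le
      linarith
    have h1 : ψ β' = ℓ β' + m₀ - ε / τ₁ := by
      simp only [hψ, hβ']
      have : β - (β - τ₁) = τ₁ := by ring
      rw [this]
    have h2 : f α - mf + 1 ≤ ε / τ₁ := by
      rw [le_div_iff₀ hτ₁pos]
      calc (f α - mf + 1) * τ₁ ≤ (f α - mf + 1) * (ε / (f α - mf + 1)) :=
            mul_le_mul_of_nonneg_left hτ₁le' hden.le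
        _ = ε := by field_simp
    have h3 : mf ≤ f β' := hmf_le β' ⟨hαβ'.le, hβ'β.le⟩
    rw [h1]; linarith
  -- minimise `F = f - ψ` on `[α, β']`
  have hψcont : ContinuousOn ψ (Icc α β') := by
    simp only [hψ, hℓ]
    refine ContinuousOn.sub (by fun_prop) (ContinuousOn.div continuousOn_const (by fun_prop) ?_)
    intro η hη; exact (sub_pos.2 (hη.2.trans_lt hβ'β)).ne'
  have hFcont : ContinuousOn (fun η ↦ f η - ψ η) (Icc α β') :=
    (hfc.mono (Icc_subset_Icc_right hβ'β.le)).sub hψcont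
  obtain ⟨ηs, hηs, hηsmin⟩ := (isCompact_Icc (a := α) (b := β')).exists_isMinOn
    (nonempty_Icc.2 hαβ'.le) hFcont
  have hFηs_neg : f ηs - ψ ηs < 0 :=
    (hηsmin (show η₁ ∈ Icc α β' from ⟨hαη₁.le, hη₁β'⟩)).trans_lt hψη₁
  have hηsα : ηs ≠ α := fun heq ↦ by rw [heq] at hFηs_neg; linarith
  have hηsβ' : ηs ≠ β' := fun heq ↦ by rw [heq] at hFηs_neg; linarith
  have hηs_int : ηs ∈ Ioo α β' := ⟨lt_of_le_of_ne hηs.1 (Ne.symm hηsα), lt_of_le_of_ne hηs.2 hηsβ'⟩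
  -- the shifted test function touches `f` from below at the interior point `ηs`
  set C := f ηs - ψ ηs with hC
  set φ₀ : ℝ → ℝ := fun η ↦ ψ η + C with hφ₀
  have hφ₀eq : φ₀ ηs = f ηs := by simp [hφ₀, hC]
  have hφ₀le : ∀ᶠ η in 𝓝 ηs, φ₀ η ≤ f η := by
    filter_upwards [Ioo_mem_nhds hηs_int.1 hηs_int.2] with η hη
    have hle : f ηs - ψ ηs ≤ f η - ψ η :=
      (isMinOn_iff.1 hηsmin) η (show η ∈ Icc α β' from ⟨hη.1.le, hη.2.le⟩)
    simp only [hφ₀, hC]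
    linarith
  have hφ₀smooth : ContDiffOn ℝ ∞ φ₀ (Iio β) := by
    simp only [hφ₀, hψ, hℓ]
    refine ContDiffOn.add (ContDiffOn.sub (by fun_prop) ?_) contDiffOn_const
    refine ContDiffOn.div contDiffOn_const (by fun_prop) ?_
    intro η hη; exact (sub_pos.2 hη).ne'
  have hderivφ₀ : deriv φ₀ ηs = k - ε / (β - ηs) ^ 2 := by
    have hne : β - ηs ≠ 0 := (sub_pos.2 (hηs_int.2.trans hβ'β)).ne'
    have h1 : HasDerivAt (fun η ↦ β - η) (-1) ηs := (hasDerivAt_id ηs).const_sub β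
    have h2 : HasDerivAt (fun η ↦ ε / (β - η)) ((0 * (β - ηs) - ε * -1) / (β - ηs) ^ 2) ηs :=
      (hasDerivAt_const ηs ε).div h1 hne
    have h3 : HasDerivAt ℓ k ηs := by
      simp only [hℓ]
      simpa using ((hasDerivAt_id ηs).sub_const β).const_mul k |>.const_add (f β)
    have h4 : HasDerivAt φ₀ (k - (0 * (β - ηs) - ε * -1) / (β - ηs) ^ 2) ηs := by
      simp only [hφ₀, hψ]
      exact ((h3.add_const m₀).sub h2).add_const C
    rw [h4.deriv]; ring
  obtain ⟨φ, hφs, hφeq⟩ := exists_contDiff_eventuallyEq (Iio_mem_nhds (hηs_int.2.trans hβ'β))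
    hφ₀smooth
  have hηs_ab : ηs ∈ Ioo a b := hIcc ⟨hηs_int.1.le, (hηs_int.2.trans hβ'β).le⟩
  have key := h ηs hηs_ab φ hφs (by rw [hφeq.eq_of_nhds, hφ₀eq])
    (by filter_upwards [hφeq, hφ₀le] with η h1 h2; rw [h1]; exact h2)
  rw [hφeq.deriv_eq, hderivφ₀] at key
  have : 0 < ε / (β - ηs) ^ 2 := div_pos hεpos (pow_pos (sub_pos.2 (hηs_int.2.trans hβ'β)) 2)
  linarith


/-- Side/sign variant: touching from ABOVE with nonpositive slopes forces antitonicity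
(apply `monotoneOn_of_touchingBelow` to `-f`). [cite: CrandallIshiiLions1992, §2] -/
theorem antitoneOn_of_touchingAbove {f : ℝ → ℝ} {a b : ℝ} (hf : ContinuousOn f (Ioo a b))
    (h : ∀ η₀ ∈ Ioo a b, ∀ φ : ℝ → ℝ, ContDiff ℝ ∞ φ → φ η₀ = f η₀ →
      (∀ᶠ η in 𝓝 η₀, f η ≤ φ η) → deriv φ η₀ ≤ 0) :
    AntitoneOn f (Ioo a b) := by
  have hg : MonotoneOn (fun η ↦ -f η) (Ioo a b) := by
    refine monotoneOn_of_touchingBelow hf.neg fun η₀ hη₀ ψ hψ hψeq hψle ↦ ?_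
    have key := h η₀ hη₀ (fun η ↦ -ψ η) hψ.neg (by simp [hψeq])
      (by filter_upwards [hψle] with η hη; linarith)
    have hd : deriv (fun η ↦ -ψ η) η₀ = -deriv ψ η₀ := deriv.neg
    linarith
  intro x hx y hy hxy
  have := hg hx hy hxy
  simpa using this

/-- Side/sign variant: touching from BELOW with nonpositive slopes forces antitonicity
(apply `monotoneOn_of_touchingBelow` to `η ↦ f (-η)`). [cite: CrandallIshiiLions1992, §2] -/
theorem antitoneOn_of_touchingBelow {f : ℝ → ℝ} {a b : ℝ} (hf : ContinuousOn f (Ioo a b))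
    (h : ∀ η₀ ∈ Ioo a b, ∀ φ : ℝ → ℝ, ContDiff ℝ ∞ φ → φ η₀ = f η₀ →
      (∀ᶠ η in 𝓝 η₀, φ η ≤ f η) → deriv φ η₀ ≤ 0) :
    AntitoneOn f (Ioo a b) := by
  have hmaps : MapsTo (fun η : ℝ ↦ -η) (Ioo (-b) (-a)) (Ioo a b) := by
    intro η hη; exact ⟨by linarith [hη.2], by linarith [hη.1]⟩
  have hg : MonotoneOn (fun η ↦ f (-η)) (Ioo (-b) (-a)) := by
    refine monotoneOn_of_touchingBelow (hf.comp continuous_neg.continuousOn hmaps)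
      fun η₀ hη₀ ψ hψ hψeq hψle ↦ ?_
    have hη₀' : -η₀ ∈ Ioo a b := hmaps hη₀
    have hle : ∀ᶠ η in 𝓝 (-η₀), ψ (-η) ≤ f η := by
      have ht : Tendsto (fun η : ℝ ↦ -η) (𝓝 (-η₀)) (𝓝 η₀) := by
        simpa using (continuous_neg.tendsto (-η₀))
      have := ht.eventually hψle
      filter_upwards [this] with η hη
      simpa using hη
    have key := h (-η₀) hη₀' (fun η ↦ ψ (-η)) (hψ.comp contDiff_neg) (by simpa using hψeq) hle
    rw [deriv_comp_neg, neg_neg] at key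
    linarith
  intro x hx y hy hxy
  have := hg (show -y ∈ Ioo (-b) (-a) from ⟨by linarith [hy.2], by linarith [hy.1]⟩)
    (show -x ∈ Ioo (-b) (-a) from ⟨by linarith [hx.2], by linarith [hx.1]⟩) (neg_le_neg hxy)
  simpa using this

/-- Side/sign variant: touching from ABOVE with nonnegative slopes forces monotonicity.
[cite: CrandallIshiiLions1992, §2] -/
theorem monotoneOn_of_touchingAbove {f : ℝ → ℝ} {a b : ℝ} (hf : ContinuousOn f (Ioo a b))
    (h : ∀ η₀ ∈ Ioo a b, ∀ φ : ℝ → ℝ, ContDiff ℝ ∞ φ → φ η₀ = f η₀ →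
      (∀ᶠ η in 𝓝 η₀, f η ≤ φ η) → 0 ≤ deriv φ η₀) :
    MonotoneOn f (Ioo a b) := by
  have hg : AntitoneOn (fun η ↦ -f η) (Ioo a b) := by
    refine antitoneOn_of_touchingBelow hf.neg fun η₀ hη₀ ψ hψ hψeq hψle ↦ ?_
    have key := h η₀ hη₀ (fun η ↦ -ψ η) hψ.neg (by simp [hψeq])
      (by filter_upwards [hψle] with η hη; linarith)
    have hd : deriv (fun η ↦ -ψ η) η₀ = -deriv ψ η₀ := deriv.neg
    linarith
  intro x hx y hy hxy
  have := hg hx hy hxy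
  simpa using this

/-- **First-order viscosity rigidity.**  If, for a nonzero constant `c`, every smooth `φ` touching
the continuous `f` from above at a point of `(a,b)` has `c·φ' ≤ 0` there and every smooth `φ`
touching from below has `0 ≤ c·φ'`, then `f` is constant on `(a,b)` (the continuous viscosity
solutions of `c u' = 0` are the constants). [cite: CrandallIshiiLions1992, §2] -/
theorem eq_of_touching {f : ℝ → ℝ} {a b c : ℝ} (hc : c ≠ 0) (hf : ContinuousOn f (Ioo a b))
    (habove : ∀ η₀ ∈ Ioo a b, ∀ φ : ℝ → ℝ, ContDiff ℝ ∞ φ → φ η₀ = f η₀ →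
      (∀ᶠ η in 𝓝 η₀, f η ≤ φ η) → c * deriv φ η₀ ≤ 0)
    (hbelow : ∀ η₀ ∈ Ioo a b, ∀ φ : ℝ → ℝ, ContDiff ℝ ∞ φ → φ η₀ = f η₀ →
      (∀ᶠ η in 𝓝 η₀, φ η ≤ f η) → 0 ≤ c * deriv φ η₀) :
    ∀ x ∈ Ioo a b, ∀ y ∈ Ioo a b, f x = f y := by
  have key : MonotoneOn f (Ioo a b) ∧ AntitoneOn f (Ioo a b) := by
    rcases lt_or_gt_of_ne hc with hneg | hpos
    · refine ⟨monotoneOn_of_touchingAbove hf fun η₀ hη₀ φ hφ h1 h2 ↦ ?_,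
        antitoneOn_of_touchingBelow hf fun η₀ hη₀ φ hφ h1 h2 ↦ ?_⟩
      · have := habove η₀ hη₀ φ hφ h1 h2
        nlinarith
      · have := hbelow η₀ hη₀ φ hφ h1 h2
        nlinarith
    · refine ⟨monotoneOn_of_touchingBelow hf fun η₀ hη₀ φ hφ h1 h2 ↦ ?_,
        antitoneOn_of_touchingAbove hf fun η₀ hη₀ φ hφ h1 h2 ↦ ?_⟩
      · have := hbelow η₀ hη₀ φ hφ h1 h2
        nlinarith
      · have := habove η₀ hη₀ φ hφ h1 h2
        nlinarith
  intro x hx y hy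
  rcases le_total x y with hxy | hxy
  · exact le_antisymm (key.1 hx hy hxy) (key.2 hx hy hxy)
  · exact le_antisymm (key.2 hy hx hxy) (key.1 hy hx hxy)

end Literature.Analysis.ODE

end
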